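import Literature.NumberTheory.Automorphic.UnitaryRankTwoTorusLocalClassFrame      -- ★ B-p12 (g29): the frame file `exists_unitary_conj_eq_normalForm_of_eigenvector`
import HarnessLib

/-!
# [Rogawski1990 §4.9; LabesseLanglands1979 §2] road «R1LL-tree», brick I-1: LEMMA U `localClass_normalForm` — the local class of an elliptic regular element of
# `U(1,1)` at a fixed vertex is `c·(1 + ϖ^i·[[0, δ],[0, 0]])` modulo `ϖ^m`, `i` = the DEPTH (eigenvector-free head)

Topic `NumberTheory/Automorphic`; namespace `Literature.NumberTheory.Automorphic`.  THEOREMS ONLY (no definition, no instance, no notation, no named fact, no `sorry`).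
Cell `pub/hodgecm-mathlib` (D-0151), crux H413 = `stmt-HodgeConjecture-24833`, line «N6nsGerm», stub `stub_N6nsR1LL` (#159 (R1-CM), letter ED. 4
`RankOneUnstableTransferNonsplitCME`); LEAD F0P3a-plan (g10) T9-8 (A)∕T9-9; architect A-p16 (g27) RULING A-1 (interface (I3′): this head VERBATIM).  HONEST LABEL: HC_CM
is proved only modulo the printed citations (the 2 remaining named inputs hLiu418, h413) until rung 0 closes; nothing printed is asserted here.

THE HEAD.  In the one-place frame of ★ (L5-d3) (`σ`, `ϖ`, `σO`, `hσσ`, `hσϖ`, a unit `σa₀ − a₀`, complete `𝒪` with finite residue field): for `k ∈ M₂(𝒪)` unitary for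
`J₀ = [[0,1],[1,0]]` with `(k − a·1)(k − c·1) = 0`, norm-one units `a, c`, `|a − c| = |ϖ^N|`, and EXACT DEPTH `i` at `c` (`k − c·1 ∈ ϖ^i M₂(𝒪) ∖ ϖ^{i+1} M₂(𝒪)`,
`i < m ≤ N`) there are `κ ∈ M₂(𝒪) ∩ U(J₀)` and `R ∈ M₂(𝒪)` with `κ⁻¹ k κ = c·(1 + ϖ^i·[[0, δ],[0, 0]]) + ϖ^m·R`, `δ := σa₀ − a₀` (`κ⁻¹ = J₀ κᴴ J₀`).  Reduction to the
frame file: a column of `k − a·1 ≠ 0` is a `c`-eigenvector `(v₀, v₁) ∈ 𝒪²`; if `|v₀| ≤ |v₁|` it normalises to `(y, 1)`, else the SWAP `S = J₀ ∈ U(J₀)(𝒪)` turns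
`k ↦ S k S` (same hypotheses, entries permuted) with eigenvector `(v₁∕v₀, 1)`, and `κ := S κ′`.  CONSUMERS: F0P2-p01 (α) depth expansion (`hU`), A-p13 I-2 depth counts,
F0P3-p01 (β) inert core, A-p19 (G4).

## References
* [Rogawski1990] J. D. Rogawski, *Automorphic Representations of Unitary Groups in Three Variables*, Ann. of Math. Stud. 123 (1990): §4.9 Lemma 4.9.3 p. 56.
* [LabesseLanglands1979] J.-P. Labesse, R. P. Langlands, *L-indistinguishability for SL(2)*, Canad. J. Math. 31 (1979): §2.
* [Jacobowitz1962] R. Jacobowitz, *Hermitian forms over local fields*, Amer. J. Math. 84 (1962): §4, §7.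
-/

set_option autoImplicit false

noncomputable section

open scoped ValuativeRel Matrix MatrixGroups
open Matrix ValuativeRel

namespace Literature.NumberTheory.Automorphic

variable {F : Type*} [Field F] [ValuativeRel F]

section Swap

variable (σ : F →+* F)

omit [ValuativeRel F] in
/-- `((!![x₀₀, x₀₁; x₁₀, x₁₁]).map σ)ᵀ`, entrywise. [cite: Jacobowitz1962, §4] -/
private theorem conjTranspose_fin_two' (x₀₀ x₀₁ x₁₀ x₁₁ : F) :
    ((!![x₀₀, x₀₁; x₁₀, x₁₁] : Matrix (Fin 2) (Fin 2) F).map σ)ᵀ = !![σ x₀₀, σ x₁₀; σ x₀₁, σ x₁₁] := by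
  ext i j; fin_cases i <;> fin_cases j <;> simp

omit [Field F] [ValuativeRel F] in
/-- Two `2×2` matrix literals agree if their entries do. [cite: Jacobowitz1962, §4] -/
private theorem fin_two_eq' {x₀₀ x₀₁ x₁₀ x₁₁ y₀₀ y₀₁ y₁₀ y₁₁ : F} (h₀₀ : x₀₀ = y₀₀) (h₀₁ : x₀₁ = y₀₁) (h₁₀ : x₁₀ = y₁₀)
    (h₁₁ : x₁₁ = y₁₁) : (!![x₀₀, x₀₁; x₁₀, x₁₁] : Matrix (Fin 2) (Fin 2) F) = !![y₀₀, y₀₁; y₁₀, y₁₁] := by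
  rw [h₀₀, h₀₁, h₁₀, h₁₁]

omit [ValuativeRel F] in
/-- The swap `S = J₀ = [[0,1],[1,0]]` squares to `1`. [cite: Jacobowitz1962, §4] -/
private theorem swap_mul_swap : (!![(0 : F), 1; 1, 0] : Matrix (Fin 2) (Fin 2) F) * !![0, 1; 1, 0] = 1 := by
  rw [Matrix.mul_fin_two, Matrix.one_fin_two]; exact fin_two_eq' (by ring) (by ring) (by ring) (by ring)

omit [ValuativeRel F] in
/-- Conjugation by the swap permutes the entries: `S M S = [[M₁₁, M₁₀],[M₀₁, M₀₀]]`. [cite: Jacobowitz1962, §4] -/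
private theorem swap_mul_mul_swap (M : Matrix (Fin 2) (Fin 2) F) :
    (!![(0 : F), 1; 1, 0] : Matrix (Fin 2) (Fin 2) F) * M * !![0, 1; 1, 0] = !![M 1 1, M 1 0; M 0 1, M 0 0] := by
  conv_lhs => rw [Matrix.eta_fin_two M]
  rw [Matrix.mul_fin_two, Matrix.mul_fin_two]; exact fin_two_eq' (by ring) (by ring) (by ring) (by ring)

omit [ValuativeRel F] in
/-- `σ` fixes the swap. [cite: Jacobowitz1962, §4] -/
private theorem swap_map : ((!![(0 : F), 1; 1, 0] : Matrix (Fin 2) (Fin 2) F).map σ)ᵀ = !![0, 1; 1, 0] := by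
  rw [conjTranspose_fin_two', map_zero, map_one]

omit [ValuativeRel F] in
/-- `S (c • 1) S = c • 1`. [cite: Jacobowitz1962, §4] -/
private theorem swap_mul_smul_one_mul_swap (c : F) :
    (!![(0 : F), 1; 1, 0] : Matrix (Fin 2) (Fin 2) F) * (c • (1 : Matrix (Fin 2) (Fin 2) F)) * !![0, 1; 1, 0] = c • (1 : Matrix (Fin 2) (Fin 2) F) := by
  rw [Matrix.mul_smul, Matrix.mul_one, Matrix.smul_mul, swap_mul_swap]

end Swap

section Head

variable (σ : F →+* F) {ϖ : F} (hϖ : IsUniformizingElement ϖ) (hσϖ : σ ϖ = ϖ)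
  (σO : 𝒪[F] →+* 𝒪[F]) (hσO : ∀ x : 𝒪[F], ((σO x : 𝒪[F]) : F) = σ x) (hσσ : ∀ x, σO (σO x) = x)

include hϖ hσϖ hσO hσσ in
/-- **LEMMA U (the local class by DEPTH).**  `k ∈ M₂(𝒪)` unitary for `J₀ = [[0,1],[1,0]]`, `(k − a·1)(k − c·1) = 0` with norm-one units `a, c`, `|a − c| = |ϖ^N|`, exact
depth `i` at `c`, `i < m ≤ N`: there are `κ ∈ M₂(𝒪)` unitary for `J₀` and `R ∈ M₂(𝒪)` with `(J₀ κᴴ J₀)·k·κ = c·(1 + ϖ^i·[[0, δ],[0, 0]]) + ϖ^m·R`,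
`δ = σa₀ − a₀` — the `U(J₀)(𝒪)`-class of `k mod ϖ^m` depends only on `(i, c mod ϖ^m)`: not on the lattice, the vertex type, `N` beyond `i`, or the angle
`(a − c)∕ϖ^N` (★ frame file + the swap `S = J₀`). [cite: LabesseLanglands1979, §2] [cite: Rogawski1990, §4.9 Lemma 4.9.3 p. 56] [cite: Jacobowitz1962, §7] -/
theorem localClass_normalForm
    [IsAdicComplete (IsLocalRing.maximalIdeal 𝒪[F]) 𝒪[F]] [Finite (IsLocalRing.ResidueField 𝒪[F])]
    {a₀ : 𝒪[F]} (ha₀ : IsUnit (σO a₀ - a₀))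
    {k : Matrix (Fin 2) (Fin 2) F} (hkO : ∀ r s, k r s ∈ 𝒪[F]) (hkU : (k.map σ)ᵀ * !![0, 1; 1, 0] * k = !![0, 1; 1, 0])
    {a c : F} (ha : σ a * a = 1) (hc : σ c * c = 1) (ha1 : valuation F a = 1) (hc1 : valuation F c = 1)
    (hac : (k - a • 1) * (k - c • 1) = 0)
    {N : ℕ} (hN : valuation F (a - c) = valuation F (ϖ ^ N))
    {i m : ℕ} (him : i < m) (hmN : m ≤ N)
    (hki : ∀ r s, ϖ ^ (-(i : ℤ)) * (k - c • 1) r s ∈ 𝒪[F]) (hki' : ¬ ∀ r s, ϖ ^ (-((i : ℤ) + 1)) * (k - c • 1) r s ∈ 𝒪[F]) :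
    ∃ κ : Matrix (Fin 2) (Fin 2) F, (∀ r s, κ r s ∈ 𝒪[F]) ∧ (κ.map σ)ᵀ * !![0, 1; 1, 0] * κ = !![0, 1; 1, 0] ∧
      ∃ R : Matrix (Fin 2) (Fin 2) F, (∀ r s, R r s ∈ 𝒪[F]) ∧
        !![0, 1; 1, 0] * (κ.map σ)ᵀ * !![0, 1; 1, 0] * k * κ =
          c • (1 + ϖ ^ i • !![0, ((σO a₀ - a₀ : 𝒪[F]) : F); 0, 0]) + ϖ ^ m • R := by
  have hϖ0 : ϖ ≠ 0 := hϖ.ne_zero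
  have haO : a ∈ 𝒪[F] := (Valuation.mem_integer_iff _ _).2 ha1.le
  -- `(k − c)(k − a) = 0` as well
  have hca : (k - c • 1) * (k - a • 1) = 0 := by
    rw [← hac]; simp only [sub_mul, mul_sub, Matrix.smul_mul, Matrix.mul_smul, Matrix.one_mul, Matrix.mul_one, smul_smul, mul_comm c a]
    abel
  -- `a − c ∈ ϖ^{i+1}𝒪`
  have hϖN1 : valuation F (ϖ ^ N) ≠ 0 := by rw [map_pow]; exact pow_ne_zero _ ((Valuation.ne_zero_iff _).2 hϖ0)
  have hzO : ϖ ^ (-((i : ℤ) + 1)) * (a - c) ∈ 𝒪[F] := by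
    have hu1 : valuation F ((a - c) * (ϖ ^ N)⁻¹) = 1 := by rw [map_mul, map_inv₀, hN, mul_inv_cancel₀ hϖN1]
    have hϖ1i : (ϖ : F) ^ (-((i : ℤ) + 1)) * ϖ ^ (i + 1) = 1 := by
      rw [← zpow_natCast, ← zpow_add₀ hϖ0, Nat.cast_add, Nat.cast_one, neg_add_cancel, zpow_zero]
    have h1 : ϖ ^ (-((i : ℤ) + 1)) * (a - c) = ϖ ^ (N - (i + 1)) * ((a - c) * (ϖ ^ N)⁻¹) := by
      rw [show (ϖ ^ N : F) = ϖ ^ (i + 1) * ϖ ^ (N - (i + 1)) by rw [← pow_add]; congr 1; omega, eq_inv_of_mul_eq_one_left hϖ1i]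
      calc (ϖ ^ (i + 1))⁻¹ * (a - c) = ϖ ^ (N - (i + 1)) * (ϖ ^ (N - (i + 1)))⁻¹ * ((ϖ ^ (i + 1))⁻¹ * (a - c)) := by
            rw [mul_inv_cancel₀ (pow_ne_zero _ hϖ0), one_mul]
        _ = ϖ ^ (N - (i + 1)) * ((a - c) * (ϖ ^ (i + 1) * ϖ ^ (N - (i + 1)))⁻¹) := by rw [mul_inv]; ring
    rw [h1]
    exact (𝒪[F]).mul_mem ((𝒪[F]).pow_mem hϖ.mem _) ((Valuation.mem_integer_iff _ _).2 hu1.le)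
  -- `k ≠ a·1`
  have hsubA : ∀ r s, (k - a • (1 : Matrix (Fin 2) (Fin 2) F)) r s = k r s - (if r = s then a else 0) := by
    intro r s; simp [Matrix.sub_apply, Matrix.smul_apply, Matrix.one_apply]
  have hsubC : ∀ r s, (k - c • (1 : Matrix (Fin 2) (Fin 2) F)) r s = k r s - (if r = s then c else 0) := by
    intro r s; simp [Matrix.sub_apply, Matrix.smul_apply, Matrix.one_apply]
  obtain ⟨r₀, s₀, hne⟩ : ∃ r₀ s₀, (k - a • (1 : Matrix (Fin 2) (Fin 2) F)) r₀ s₀ ≠ 0 := by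
    by_contra h
    simp only [not_exists, not_not] at h
    apply hki'
    intro r s
    have hrs : k r s = if r = s then a else 0 := by have := h r s; rw [hsubA] at this; exact sub_eq_zero.1 this
    rw [hsubC, hrs]
    by_cases hrs' : r = s
    · rw [if_pos hrs', if_pos hrs']; exact hzO
    · rw [if_neg hrs', if_neg hrs', sub_zero, mul_zero]; exact (𝒪[F]).zero_mem
  -- the column `s₀` of `k − a·1` is a `c`-eigenvector with integral entries
  set v0 : F := (k - a • (1 : Matrix (Fin 2) (Fin 2) F)) 0 s₀ with hv0
  set v1 : F := (k - a • (1 : Matrix (Fin 2) (Fin 2) F)) 1 s₀ with hv1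
  have hvO : ∀ r, (k - a • (1 : Matrix (Fin 2) (Fin 2) F)) r s₀ ∈ 𝒪[F] := by
    intro r; rw [hsubA]
    by_cases h : r = s₀
    · rw [if_pos h]; exact (𝒪[F]).sub_mem (hkO r s₀) haO
    · rw [if_neg h, sub_zero]; exact hkO r s₀
  have hv0O : v0 ∈ 𝒪[F] := hvO 0
  have hv1O : v1 ∈ 𝒪[F] := hvO 1
  have hev0 : k 0 0 * v0 + k 0 1 * v1 = c * v0 := by
    have h := congr_fun (congr_fun hca 0) s₀
    simp only [Matrix.mul_apply, Fin.sum_univ_two, Matrix.zero_apply] at h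
    rw [hsubC, hsubC, if_pos rfl, if_neg (by decide)] at h
    rw [hv0, hv1]; linear_combination h
  have hev1 : k 1 0 * v0 + k 1 1 * v1 = c * v1 := by
    have h := congr_fun (congr_fun hca 1) s₀
    simp only [Matrix.mul_apply, Fin.sum_univ_two, Matrix.zero_apply] at h
    rw [hsubC, hsubC, if_neg (by decide), if_pos rfl] at h
    rw [hv0, hv1]; linear_combination h
  have hvne : v0 ≠ 0 ∨ v1 ≠ 0 := by
    revert hne; refine Fin.cases ?_ (fun j => ?_) r₀
    · intro h; exact Or.inl h
    · intro h; fin_cases j; exact Or.inr h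
  clear_value v0 v1
  by_cases hle : valuation F v0 ≤ valuation F v1
  · -- eigenvector `(y, 1)`, `y = v0 ∕ v1`
    have hv10 : v1 ≠ 0 := by
      rintro rfl
      rw [map_zero, le_zero_iff, Valuation.zero_iff] at hle
      exact hvne.elim (fun h => h hle) (fun h => h rfl)
    have hyO : v0 * v1⁻¹ ∈ 𝒪[F] := by
      rw [Valuation.mem_integer_iff, map_mul, map_inv₀]
      exact mul_inv_le_one_of_le₀ hle zero_le
    refine exists_unitary_conj_eq_normalForm_of_eigenvector σ hϖ hσϖ σO hσO hσσ ha₀ hkO hkU ha hc ha1 hc1 hac hN hyO ?_ ?_ him hmN hki hki'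
    · field_simp; linear_combination hev0
    · field_simp; linear_combination hev1
  · -- eigenvector `(1, y)`: swap
    have hlt : valuation F v1 < valuation F v0 := not_le.1 hle
    have hv00 : v0 ≠ 0 := by rintro rfl; rw [map_zero] at hlt; exact not_lt_zero hlt
    have hyO : v1 * v0⁻¹ ∈ 𝒪[F] := by
      rw [Valuation.mem_integer_iff, map_mul, map_inv₀]
      exact mul_inv_le_one_of_le₀ hlt.le zero_le
    obtain ⟨S, hS⟩ : ∃ S : Matrix (Fin 2) (Fin 2) F, S = !![0, 1; 1, 0] := ⟨_, rfl⟩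
    obtain ⟨k', hk'⟩ : ∃ k' : Matrix (Fin 2) (Fin 2) F, k' = S * k * S := ⟨_, rfl⟩
    have hk'e : k' = !![k 1 1, k 1 0; k 0 1, k 0 0] := by rw [hk', hS, swap_mul_mul_swap]
    have hk'O : ∀ r s, k' r s ∈ 𝒪[F] := by
      rw [hk'e]
      refine Fin.forall_fin_two.2 ⟨Fin.forall_fin_two.2 ⟨?_, ?_⟩, Fin.forall_fin_two.2 ⟨?_, ?_⟩⟩ <;> simp [hkO]
    have hSS : S * S = 1 := by rw [hS]; exact swap_mul_swap
    have hSσ : (S.map σ)ᵀ = S := by rw [hS]; exact swap_map σ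
    rw [← hS] at hkU
    have hk'U : (k'.map σ)ᵀ * !![0, 1; 1, 0] * k' = !![0, 1; 1, 0] := by
      rw [← hS, hk', Matrix.map_mul, Matrix.map_mul, Matrix.transpose_mul, Matrix.transpose_mul, hSσ]
      calc S * ((k.map σ)ᵀ * S) * S * (S * k * S) = S * ((k.map σ)ᵀ * (S * S) * (S * k)) * S := by simp only [Matrix.mul_assoc]
        _ = S := by rw [hSS, Matrix.mul_one, ← Matrix.mul_assoc (k.map σ)ᵀ, hkU, hSS, Matrix.one_mul]
    have hconj : ∀ x : F, k' - x • 1 = S * (k - x • 1) * S := by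
      intro x; rw [hk', Matrix.mul_sub, Matrix.sub_mul, hS, swap_mul_smul_one_mul_swap]
    have hac' : (k' - a • 1) * (k' - c • 1) = 0 := by
      rw [hconj, hconj]
      calc S * (k - a • 1) * S * (S * (k - c • 1) * S) = S * ((k - a • 1) * (S * S) * (k - c • 1)) * S := by simp only [Matrix.mul_assoc]
        _ = 0 := by rw [hSS, Matrix.mul_one, hac, Matrix.mul_zero, Matrix.zero_mul]
    have hsub' : k' - c • 1 = !![(k - c • 1) 1 1, (k - c • 1) 1 0; (k - c • 1) 0 1, (k - c • 1) 0 0] := by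
      rw [hconj, hS, swap_mul_mul_swap]
    have hki₂ : ∀ r s, ϖ ^ (-(i : ℤ)) * (k' - c • 1) r s ∈ 𝒪[F] := by
      rw [hsub']
      refine Fin.forall_fin_two.2 ⟨Fin.forall_fin_two.2 ⟨?_, ?_⟩, Fin.forall_fin_two.2 ⟨?_, ?_⟩⟩
      · simpa using hki 1 1
      · simpa using hki 1 0
      · simpa using hki 0 1
      · simpa using hki 0 0
    have hki₂' : ¬ ∀ r s, ϖ ^ (-((i : ℤ) + 1)) * (k' - c • 1) r s ∈ 𝒪[F] := by
      intro h; apply hki'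
      rw [hsub'] at h
      refine Fin.forall_fin_two.2 ⟨Fin.forall_fin_two.2 ⟨?_, ?_⟩, Fin.forall_fin_two.2 ⟨?_, ?_⟩⟩
      · simpa using h 1 1
      · simpa using h 1 0
      · simpa using h 0 1
      · simpa using h 0 0
    have hk'0 : k' 0 0 * (v1 * v0⁻¹) + k' 0 1 = c * (v1 * v0⁻¹) := by
      rw [hk'e]; simp only [Matrix.of_apply, Matrix.cons_val', Matrix.cons_val_zero, Matrix.cons_val_one, Matrix.cons_val_fin_one,
        Matrix.empty_val']
      field_simp; linear_combination hev1
    have hk'1 : k' 1 0 * (v1 * v0⁻¹) + k' 1 1 = c := by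
      rw [hk'e]; simp only [Matrix.of_apply, Matrix.cons_val', Matrix.cons_val_zero, Matrix.cons_val_one, Matrix.cons_val_fin_one,
        Matrix.empty_val']
      field_simp; linear_combination hev0
    obtain ⟨κ', hκ'O, hκ'U, R, hRO, hR⟩ := exists_unitary_conj_eq_normalForm_of_eigenvector σ hϖ hσϖ σO hσO hσσ ha₀ hk'O hk'U ha hc ha1 hc1
      hac' hN hyO hk'0 hk'1 him hmN hki₂ hki₂'
    rw [← hS] at hκ'U hR ⊢
    refine ⟨S * κ', ?_, ?_, R, hRO, ?_⟩
    · have hS' : S * κ' = !![κ' 1 0, κ' 1 1; κ' 0 0, κ' 0 1] := by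
        rw [hS]; conv_lhs => rw [Matrix.eta_fin_two κ']
        rw [Matrix.mul_fin_two]; exact fin_two_eq' (by ring) (by ring) (by ring) (by ring)
      rw [hS']
      refine Fin.forall_fin_two.2 ⟨Fin.forall_fin_two.2 ⟨?_, ?_⟩, Fin.forall_fin_two.2 ⟨?_, ?_⟩⟩ <;> simp [hκ'O]
    · rw [Matrix.map_mul, Matrix.transpose_mul, hSσ]
      calc (κ'.map σ)ᵀ * S * S * (S * κ') = (κ'.map σ)ᵀ * (S * S) * S * κ' := by simp only [Matrix.mul_assoc]
        _ = S := by rw [hSS, Matrix.mul_one, hκ'U]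
    · rw [Matrix.map_mul, Matrix.transpose_mul, hSσ]
      rw [hk'] at hR
      have hSS' : ∀ X : Matrix (Fin 2) (Fin 2) F, S * (S * X) = X := fun X => by rw [← Matrix.mul_assoc, hSS, Matrix.one_mul]
      calc S * ((κ'.map σ)ᵀ * S) * S * k * (S * κ') = S * (κ'.map σ)ᵀ * S * (S * k * S) * κ' := by simp only [Matrix.mul_assoc, hSS']
        _ = _ := hR

end Head

end Literature.NumberTheory.Automorphic

end
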